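import Mathlib
import Literature.Geometry.Lorentzian.ReggeWheelerChannels
import Literature.Geometry.Lorentzian.ReggeWheelerTortoise
import Summits.FinalStateConjecture.FinalStateConjecture.Theorems.PhotonSphereChannelsTortoiseFar

/-!
# Crux `UniformPhotonSphereChannelsR` (K1R, stmt-FinalStateConjecture-14074), line
# `crum-peeling-recessive-tower` — stub R₀: the rung-free case `ℓ = 0` of the residual bound

The registered stub `stub_residualZero` of the line's skeleton v3 (continuation lead c1).  For
`ℓ = 0` (hence `s = 0`) the recessive Crum ladder has no rung and the "residual" is the potential
itself, `U 0 = V_{0,0} = (1 − 2M/r)·2M/r³ = 2M(r − 2M)/r⁴` on `(a, ∞)`.  It is nonnegative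
(`r > 2M`), non-increasing in the tortoise coordinate on `[x_c + ρ, ∞)` for `ρ ≥ 0` (the map
`ϱ ↦ 2M(ϱ − 2M)/ϱ⁴` is antitone on `[8M/3, ∞)`, `r ≥ 3M` to the right of the photon sphere and `r`
increases), and `1/16`-sub-Hardy from the edge `x_f = x_c + ρ` once `ρ ≥ 200M`:
`t²·V_{0,0}(x_f + t) ≤ 2M t²/r(x_f + t)³ ≤ 54M t²/(209M + t)³ ≤ 1/16`, using
`r(x) ≥ 3M + (x − x_c)/3` (`Theorems.tortoise_ge_third`).
-/

-- `Summit.<S>.<S>` repeats a namespace component by design (D-0017); off here as in the lakefile.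
set_option linter.dupNamespace false

namespace Summit.FinalStateConjecture.FinalStateConjecture.Theorems.CrumPeelingRecessiveTower

open Set Literature.Geometry.Lorentzian Literature.Geometry.Lorentzian.ReggeWheeler

/-- The model function `ϱ ↦ 2M(ϱ − 2M)/ϱ⁴` (`= V_{0,0}` as a function of the area radius) is antitone
on `[8M/3, ∞)` for `M > 0`: its derivative is `2M(8M − 3ϱ)/ϱ⁵ ≤ 0` there. -/
theorem antitoneOn_residualZero_model {M : ℝ} (hM : 0 < M) :
    AntitoneOn (fun ϱ : ℝ => 2 * M * (ϱ - 2 * M) / ϱ ^ 4) (Ici (8 * M / 3)) := by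
  have h83 : 0 < 8 * M / 3 := by positivity
  have hd : ∀ ϱ : ℝ, 0 < ϱ → HasDerivAt (fun ϱ : ℝ => 2 * M * (ϱ - 2 * M) / ϱ ^ 4)
      ((2 * M * 1 * ϱ ^ 4 - 2 * M * (ϱ - 2 * M) * (4 * ϱ ^ 3)) / (ϱ ^ 4) ^ 2) ϱ := by
    intro ϱ hϱ
    have h1 : HasDerivAt (fun ϱ : ℝ => 2 * M * (ϱ - 2 * M)) (2 * M * 1) ϱ :=
      ((hasDerivAt_id ϱ).sub_const (2 * M)).const_mul (2 * M)
    have h2 : HasDerivAt (fun ϱ : ℝ => ϱ ^ 4) (4 * ϱ ^ 3) ϱ := by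
      simpa using hasDerivAt_pow 4 ϱ
    exact h1.div h2 (by positivity)
  refine antitoneOn_of_deriv_nonpos (convex_Ici _) ?_ ?_ ?_
  · intro ϱ hϱ
    exact (hd ϱ (lt_of_lt_of_le h83 hϱ)).continuousAt.continuousWithinAt
  · intro ϱ hϱ
    rw [interior_Ici] at hϱ
    exact (hd ϱ (h83.trans hϱ)).differentiableAt.differentiableWithinAt
  · intro ϱ hϱ
    rw [interior_Ici] at hϱ
    have hϱ0 : 0 < ϱ := h83.trans hϱ
    rw [(hd ϱ hϱ0).deriv]
    apply div_nonpos_of_nonpos_of_nonneg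
    · have h3 : 0 ≤ ϱ ^ 3 := by positivity
      have h8 : 8 * M - 3 * ϱ ≤ 0 := by
        have : 8 * M / 3 < ϱ := hϱ
        rw [div_lt_iff₀ (by norm_num : (0 : ℝ) < 3)] at this
        linarith
      have key : 2 * M * 1 * ϱ ^ 4 - 2 * M * (ϱ - 2 * M) * (4 * ϱ ^ 3)
          = 2 * M * ϱ ^ 3 * (8 * M - 3 * ϱ) := by ring
      rw [key]
      exact mul_nonpos_of_nonneg_of_nonpos (by positivity) h8
    · positivity

/-- **Stub R₀ (`ℓ = 0`).**  With `ρ₄ := 200M`: along every tortoise radius function, for every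
`ρ ≥ ρ₄` and every `U 0` agreeing with `V_{0,0} = linePotential M 0 0 r` on a neighbourhood `(a, ∞)`
of `[x_c + ρ, ∞)`, the three residual clauses hold: `U 0 ≥ 0` on `(a, ∞)`, `U 0` antitone on
`[x_c + ρ, ∞)`, and `t²·U 0 (x_c + ρ + t) ≤ 1/16` for `t > 0`. -/
theorem stub_residualZero :
    ∀ M : ℝ, 0 < M → ∃ ρ₄ : ℝ, 0 ≤ ρ₄ ∧
      ∀ (r : ℝ → ℝ) (xc : ℝ), IsTortoiseRadius M r xc →
        ∀ ρ : ℝ, ρ₄ ≤ ρ → ∀ (U : ℕ → ℝ → ℝ) (a : ℝ), a < xc + ρ →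
          (∀ x, a < x → U 0 x = linePotential M 0 0 r x) →
          (∃ a' : ℝ, a ≤ a' ∧ a' < xc + ρ ∧ ∀ x, a' < x → 0 ≤ U 0 x) ∧
          AntitoneOn (U 0) (Set.Ici (xc + ρ)) ∧
          ∀ t : ℝ, 0 < t → t ^ 2 * U 0 (xc + ρ + t) ≤ 1 / 16 := by
  intro M hM
  refine ⟨200 * M, by positivity, ?_⟩
  intro r xc hr ρ hρ U a ha hU0
  have hρ0 : 0 ≤ ρ := le_trans (by positivity) hρ
  -- the explicit potential `V_{0,0} = 2M(r − 2M)/r⁴`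
  have hV : ∀ x, a < x → U 0 x = 2 * M * (r x - 2 * M) / r x ^ 4 := by
    intro x hx
    have hr0 : r x ≠ 0 := (hr.pos x).ne'
    rw [hU0 x hx, linePotential_apply, rwPotential_zero]
    field_simp
    push_cast
    ring
  -- `r ≥ 3M` to the right of the photon sphere
  have hr3 : ∀ x, xc ≤ x → 3 * M ≤ r x := by
    intro x hx
    rcases eq_or_lt_of_le hx with h | h
    · rw [← h, hr.center]
    · have := hr.strictMono h
      rw [hr.center] at this
      exact this.le
  refine ⟨⟨a, le_rfl, ha, fun x hx => ?_⟩, ?_, ?_⟩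
  · -- nonnegativity on `(a, ∞)`
    rw [hU0 x hx]
    exact linePotential_nonneg hr.mass_pos.le le_rfl hr.two_mul_lt x
  · -- antitone on `[xc + ρ, ∞)`
    intro x hx y hy hxy
    have hxa : a < x := lt_of_lt_of_le ha hx
    have hya : a < y := lt_of_lt_of_le ha hy
    have hx3 : 8 * M / 3 ≤ r x := by
      have := hr3 x (by have h : xc + ρ ≤ x := hx; linarith)
      linarith
    have hy3 : 8 * M / 3 ≤ r y := by
      have := hr3 y (by have h : xc + ρ ≤ y := hy; linarith)
      linarith
    rw [hV x hxa, hV y hya]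
    exact antitoneOn_residualZero_model hM hx3 hy3 (hr.strictMono.monotone hxy)
  · -- sub-Hardy: `t²·V_{0,0}(x_f + t) ≤ 2M t²/r³ ≤ 54M t²/(209M + t)³ ≤ 1/16`
    intro t ht
    set x : ℝ := xc + ρ + t with hxdef
    have hxa : a < x := by rw [hxdef]; linarith
    have hxc : xc ≤ x := by rw [hxdef]; linarith
    have hthird : 3 * M + (x - xc) / 3 ≤ r x :=
      tortoise_ge_third hM hr.two_mul_lt hr.hasDerivAt hr.center hxc
    have hrlow : (209 * M + t) / 3 ≤ r x := by
      have hxx : x - xc = ρ + t := by rw [hxdef]; ring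
      rw [hxx] at hthird
      linarith
    have hc : 0 < (209 * M + t) / 3 := by positivity
    have hrpos : 0 < r x := hr.pos x
    -- `V ≤ 2M/r³`
    have hUle : U 0 x ≤ 2 * M / r x ^ 3 := by
      rw [hV x hxa]
      rw [div_le_div_iff₀ (by positivity) (by positivity)]
      have h2M : 0 < 2 * M := by positivity
      nlinarith [pow_pos hrpos 3, pow_pos hrpos 4, mul_pos h2M (pow_pos hrpos 3)]
    -- `2M/r³ ≤ 2M/((209M+t)/3)³`
    have hmono : 2 * M / r x ^ 3 ≤ 2 * M / ((209 * M + t) / 3) ^ 3 := by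
      apply div_le_div_of_nonneg_left (by positivity) (by positivity)
      exact pow_le_pow_left₀ hc.le hrlow 3
    -- the scalar inequality `54M t²/(209M+t)³ ≤ 1/16`
    have hscal : t ^ 2 * (2 * M / ((209 * M + t) / 3) ^ 3) ≤ 1 / 16 := by
      have hpos : 0 < (209 * M + t) ^ 3 := by positivity
      have hrew : t ^ 2 * (2 * M / ((209 * M + t) / 3) ^ 3)
          = 54 * M * t ^ 2 / (209 * M + t) ^ 3 := by
        field_simp
        ring
      rw [hrew, div_le_iff₀ hpos]
      nlinarith [mul_nonneg ht.le (sq_nonneg (2 * t - 237 * M)), mul_pos hM ht,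
        pow_pos hM 3, pow_pos hM 2, mul_pos (mul_pos hM hM) ht]
    calc t ^ 2 * U 0 x ≤ t ^ 2 * (2 * M / r x ^ 3) := by
          exact mul_le_mul_of_nonneg_left hUle (by positivity)
      _ ≤ t ^ 2 * (2 * M / ((209 * M + t) / 3) ^ 3) := by
          exact mul_le_mul_of_nonneg_left hmono (by positivity)
      _ ≤ 1 / 16 := hscal

end Summit.FinalStateConjecture.FinalStateConjecture.Theorems.CrumPeelingRecessiveTower
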